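import Summits.ABC.IUTFork.Joshi.ATS4MainBoundsGenuineTheta
import HarnessLib

/-!
# Joshi, *Arithmetic Teichmüller spaces IV* [J-IV] Theorem 4.6.1 (5) read at `L′/L` (T-30's `MainBoundDatum.WildBoundLp`)
# — DECIDED at the genuine theta tower above the degree floor `2ℓ² ≤ [L′ : L]`; the `L′/L`-level Step (ii) display hypothesis-free

Proof-only companion (slot T-27 lineage of plan/E/ASSIGNMENTS.md; abc-iut cell, block E, rung LADDER-ABC:A2.E; R-J census row
Y-21x⟨WildBoundLp⟩ / Y-22 of plan/E/R-J/Y-CENSUS.tsv, whose «next action» names this item) of `Joshi/ATS4MainBoundsWildGenuine.lean`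
(p439082, whose header records «the typed `WildBoundL`/`WildBoundLp` are NOT derived»), `Joshi/ATS4MainBoundsGenuine.lean` (T-30, p439256)
and `Joshi/ATS4MainBoundsGenuineTheta.lean` (p440894). TAKES NO SIDE on [IUTchIII] Cor. 3.12, on Joshi's claims, or on Mochizuki's
reports on them; the source is an unrefereed arXiv preprint (arXiv:2403.10430v2, bib `Joshi2024ATS4`); typed ≠ proved ≠ endorsed.
NOT an abc claim and not S-bearing: `WildBoundLp` enters the §6 spine only through `MainBoundDatum.lem642a_of`, whose conclusion the
genuine route already proves (`thetaTower_lem642a`); this file settles the STAND-ALONE truth of the predicate at genuine carriers.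

## The predicate (T-30, `Joshi/ATS4MainBounds.lean`)

`MainBoundDatum.WildBoundLp : (log d^{L′} + log f^{L′}) − (log d^L + log f^L) ≤ 1·log [L′ : L]` — [J-IV] Thm. 4.6.1 (5), p.46
l.42–46 («`(log d_M + log f_M) − (log d_L + log f_L) ≤ #S^ℚ_wild · log([M : L])`») read, as in the proof of Lem. 6.4.2 (p.60
l.22–30; l.25 «Since `L′/L` is tamely ramified outside `{ℓ}`»), at `M = L′ ⊇ L` with `S^ℚ_wild = {ℓ}`. The lemma cited there for the
tameness, Lem. 4.1.4 (2), PRINTS «`L′/L` is tamely ramified outside `{v ∈ V_{L_tpd} : v` divides `2·ℓ}`» (p.38 l.36–39; flag F-f of the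
cell), i.e. `S^ℚ_wild ⊆ {2, ℓ}` — which is exactly the shape `+ 2·log ℓ + log 2` that §2 below proves hypothesis-free (r1: locator
sentence corrected; no declaration changed).

## The genuine theta tower (as in `ATS4MainBoundsGenuineTheta.lean`; Joshi's `L_tpd ⊆ L ⊆ L′` ↦ Mochizuki's `F_tpd ⊆ F ⊆ K`, Rmk. 6.1.2)

`P : NFPoint` with `λ ∈ U_X(F_tpd)` (`P.InU`), `F` a theta field of `P` (`Cor22.IsThetaField P F`: «`F = F_tpd(√−1, E_{F_tpd}[3·5])`»,
§4.1.2 (9)), `K ⊇ F` Galois inside the `ℓ`-division field of the Legendre curve `E_F` (an `F`-embedding `ψ : K → F̄` with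
`ker ρ̄_{E_F,ℓ} ≤ Gal(F̄/ψ K)`), `ℓ ≥ 5` prime; Tate-divisor data `TateDivisorDatum.ofNFPoint(Over) P {2,ℓ} (·)` (T-26: `V` = bad places of
odd residue characteristic `≠ ℓ`); the datum is `MainBoundDatum.ofGenuine L_mod … (ofNFPoint P {2,ℓ}) (ofNFPointOver P {2,ℓ} F)
(ofNFPointOver P {2,ℓ} K) hq`.

## Results

§1 `sharp642_of_tame` — for ACTUAL number fields `L ⊆ L′`, `L′/L` Galois with `[L′:L] ∣ ℓ(ℓ−1)²(ℓ+1)` (`Gal ↪ GL₂(𝔽_ℓ)`), `Supp(𝔮_{L′})`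
  over `Supp(𝔮_L)`, `L′/L` TAME at every place of residue characteristic `≠ ℓ` and unramified at those of residue characteristic
  `∉ {2, ℓ}` off `Supp(𝔮_L)`: **`log d^{L′} + log f^{L′} ≤ log d^L + log f^L + 2·log ℓ + log 2`**. (T-30's `ofGenuine_sharp642` has
  `+ 2·log ℓ` but asks «unramified off `Supp(𝔮)` at residue characteristic `≠ ℓ`», which FAILS at bad places over `2` — excluded from
  Joshi's `V^{odd,ss}` / the tree's `{2,ℓ}`-avoiding conductor, yet `L(E[ℓ])/L` may ramify there with index `ℓ`; this is why
  `thetaTower_sharp642` (p440894) is stated relative to `L_tpd`.) Route: the tree's c-form `ndeg_different_add_reduced_le` ([IUTchIV]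
  Step (ii) engine, `DifferentConductorTowerBounds.lean`) with `P = {2, ℓ}`, `c(ℓ) = 2` (Dedekind–Hensel,
  `multiplicity_differentIdeal_lt_of_isGalois`) and `c(2) = 1` (tame: `ord_u 𝔡_{L′/L} ≤ e(u|v) − 1 < e(u|2)`, Neukirch III (2.6),
  `multiplicity_differentIdeal_le_of_not_dvd`).
§2 At the genuine theta tower, HYPOTHESIS-FREE beyond the tower data: `thetaTower_sharp642KF` (**`+ 2·log ℓ + log 2`**; tameness over `2`
  is `not_dvd_ramificationIdx_divisionTower`, Prop. 1.8 (vii)), and `thetaTower_sharp642KF_of_good_over_two` (**`+ 2·log ℓ`**) under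
  Joshi's Prop. 4.1.1 (2)-type hypothesis «no bad place of `λ` over `2`» (p.38 l.17 «`C/L` has good or additive reduction if
  `v | 2ℓ`»; then T-30's `ofGenuine_sharp642` applies verbatim); `thetaTower_wildBoundLp_honest` — Thm. 4.6.1 (5) at `L′/L` HOLDS WITH
  THE ADDITIVE WILD CORRECTION: `Δ ≤ 1·log[L′:L] + (2·log ℓ + log 2)`.
§3 **`WildBoundLp` DERIVED at the genuine theta tower above a degree floor**: `thetaTower_wildBoundLp_of_le_finrank`
  (`2ℓ² ≤ [L′:L]`), `thetaTower_wildBoundLp_of_sq_le_finrank` (`ℓ² ≤ [L′:L]`, no bad place over `2`), and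
  `thetaTower_wildBoundLp_of_card_SL_le` (`ℓ(ℓ²−1) ≤ [L′:L]`) — the last floor is `|SL₂(𝔽_ℓ)|`, so it holds for Joshi's `L′ = L(E[ℓ])`
  whenever «the image of `G_L → GL₂(𝔽_ℓ)` contains `SL₂(𝔽_ℓ)`» ([IUTchI] Def. 3.1 (c), the tree's `ImageContainsSL2`; the degree
  consequence is taken as the hypothesis, not rebuilt here).

## What stays LOCATED here (recorded, not adjudicated)

Below the floor the predicate depends on `K`: for a SMALL Galois layer inside `L(E[ℓ])`, e.g. `K = L(√ℓ*) ⊆ L(ζ_ℓ) ⊆ L(E[ℓ])` with `ℓ`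
unramified in `L`, one has `Δ = ½·log ℓ > log 2 = log[K:L]` for `ℓ ≥ 5` (tame, `e = 2` at every place over `ℓ`, unramified
elsewhere), so the SHAPE «`Δ ≤ 1·log[L′:L]`» is not a theorem about every Galois `K ⊆ L(E[ℓ])`; the dividing line is exactly
`MainBoundDatum.wildBoundLp_iff` below. At ABSTRACT genuine number-field data the negative member is kernel-feasible (a proper subfield
of `ℚ(ζ_ℓ)` of degree `d < ℓ/2` over `ℚ`, via `𝔭^{d−1} ∣ 𝔡`; E-t28's disjoint companion `Joshi/TestATS4WildBoundLpGenuine.lean`), while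
prime-power cyclotomic LAYERS `ℚ(ζ_{p^k})/ℚ(ζ_{p^j})` sit ON the line `Δ = (k−j)·log p = log[K:F]`; at a THETA FIELD a negative member
needs `μ_ℓ ⊂ L(E[ℓ])` (Weil pairing), which the tree does not have — so the theta-tower negative stays located.

Theorems only; standard axioms; no `sorry`, instance, notation or new `Prop`; DEFS-FREEZE respected (every cited decl consumed BY NAME).
-/

noncomputable section

open NumberField IsDedekindDomain Literature.IUT.LogVolume Literature.IUT.LogVolume.Cor22
open Literature.NumberTheory.DiophantineGeometry.GenEll
open Literature.NumberTheory.NumberFields (multiplicity_differentIdeal_le_of_not_dvd multiplicity_differentIdeal_lt_of_isGalois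
  ramificationIdx_rel_dvd_ramificationIdx_int)

namespace Summit.ABC.IUTFork.Joshi.ATS4

/-! ## 0. The dividing line on the abstract datum -/

namespace MainBoundDatum

variable (D : MainBoundDatum)

/-- `WildBoundLp` unfolded: «`log d^{L′} + log f^{L′} ≤ log d^L + log f^L + log[L′:L]`» — the dividing line every instance below is
measured against. [claim: Joshi2024ATS4, status: disputed] -/
theorem wildBoundLp_iff : D.WildBoundLp ↔ D.logDiffLp + D.logCondLp ≤ D.logDiffL + D.logCondL + Real.log D.degLpL := by
  unfold WildBoundLp
  constructor <;> intro h <;> linarith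

/-- A Step (ii)-shaped bound `log d^{L′} + log f^{L′} ≤ log d^L + log f^L + c` with `c ≤ log[L′:L]` gives `WildBoundLp`.
[claim: Joshi2024ATS4, status: disputed] -/
theorem wildBoundLp_of_sharp_le {c : ℝ} (h : D.logDiffLp + D.logCondLp ≤ D.logDiffL + D.logCondL + c)
    (hc : c ≤ Real.log D.degLpL) : D.WildBoundLp := by
  rw [wildBoundLp_iff]
  linarith

end MainBoundDatum

/-! ## 1. The `L′/L`-level Step (ii) display for actual number fields, tame over `2` (constant `2·log ℓ + log 2`) -/

section Fields

variable {L L' : Type*} [Field L] [NumberField L] [Field L'] [NumberField L'] [Algebra L L']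
variable {ℓ : ℕ} (hℓ : ℓ.Prime) (h5 : 5 ≤ ℓ) (𝔮L : TateDivisorDatum L) (𝔮L' : TateDivisorDatum L')

include hℓ h5 in
/-- **`log(d^{L′}) + log(f^{L′}) ≤ log(d^L) + log(f^L) + 2·log ℓ + log 2`** for `L′/L` Galois with `[L′ : L] ∣ ℓ·(ℓ−1)²·(ℓ+1)`
(`Gal(L′/L) ↪ GL₂(𝔽_ℓ)`, Lem. 6.3.2; p.60 l.26–27), `Supp(𝔮_{L′})` the inverse image of `Supp(𝔮_L)`, `L′/L` unramified at residue
characteristic `∉ {2, ℓ}` off `Supp(𝔮_L)` and TAME at every place of residue characteristic `≠ ℓ` (on or off `Supp(𝔮_L)`, in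
particular over `2`) — [IUTchIV] Step (ii), third display, with the prime `2` carried as an extra tame prime: the tree's c-form
`ndeg_different_add_reduced_le` with `P = {2,ℓ}`, `c(ℓ) = 2` (`ord_u 𝔡_{L′/L} < 2·e(u|ℓ)`, Dedekind–Hensel with `v_ℓ(|GL₂(𝔽_ℓ)|) = 1`)
and `c(2) = 1` (`ord_u 𝔡_{L′/L} ≤ e(u|v) − 1 < e(u|2)` at a tame `u`, Neukirch III (2.6)). [claim: Mochizuki2012, status: disputed] -/
theorem sharp642_of_tame [IsGalois L L'] (hV' : ∀ u : HeightOneSpectrum (𝓞 L'), u ∈ 𝔮L'.V ↔ finBelow L L' u ∈ 𝔮L.V)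
    (hdvd' : Module.finrank L L' ∣ ℓ * (ℓ - 1) ^ 2 * (ℓ + 1))
    (hunr' : ∀ u : HeightOneSpectrum (𝓞 L'), residueChar L' u ≠ ℓ → residueChar L' u ≠ 2 → finBelow L L' u ∉ 𝔮L.V →
      u.asIdeal.ramificationIdx (𝓞 L) = 1)
    (htame' : ∀ u : HeightOneSpectrum (𝓞 L'), residueChar L' u ≠ ℓ → ¬ residueChar L' u ∣ u.asIdeal.ramificationIdx (𝓞 L)) :
    logDifferent L' + 𝔮L'.logf ≤ logDifferent L + 𝔮L.logf + (2 * Real.log ℓ + Real.log 2) := by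
  classical
  have h2ℓ : (2 : ℕ) ≠ ℓ := by omega
  have hP : ∀ p ∈ ({2, ℓ} : Finset ℕ), p.Prime := by
    intro p hp
    simp only [Finset.mem_insert, Finset.mem_singleton] at hp
    rcases hp with rfl | rfl
    · exact Nat.prime_two
    · exact hℓ
  set N : ℕ := ℓ * (ℓ + 1) * (ℓ - 1) ^ 2 with hNdef
  have hN : N ≠ 0 :=
    Nat.mul_ne_zero (Nat.mul_ne_zero hℓ.ne_zero (Nat.succ_ne_zero ℓ)) (pow_ne_zero 2 (by omega))
  have hdvdN : Module.finrank L L' ∣ N := by rwa [hNdef, mul_right_comm]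
  have hfac : N.factorization ℓ ≤ 1 := by
    by_contra hlt
    exact (Thm110StepII.PlaceData.GL2_card_l_part ℓ hℓ h5).2 ((hℓ.pow_dvd_iff_le_factorization hN).mpr (by omega))
  let c : ℕ → ℕ := fun p => if p = ℓ then 2 else 1
  have key := ndeg_different_add_reduced_le L L' 𝔮L.V 𝔮L'.V hV' {2, ℓ} hP c
    (fun u hu hS => by
      simp only [Finset.mem_insert, Finset.mem_singleton, not_or] at hu
      exact hunr' u hu.2 hu.1 hS)
    (fun u hu _ => by
      simp only [Finset.mem_insert, Finset.mem_singleton, not_or] at hu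
      exact htame' u hu.2)
    (fun u hu => by
      haveI : u.asIdeal.IsMaximal := u.isMaximal
      simp only [Finset.mem_insert, Finset.mem_singleton] at hu
      rcases hu with h2 | hl
      · -- over `2`: tame, `ord_u 𝔡 ≤ e(u|v) - 1 ≤ e(u|v) ≤ e(u|2)`
        have hc : c (residueChar L' u) = 1 := by simp only [c, h2, if_neg h2ℓ]
        rw [hc, one_mul]
        have ht : ¬ residueChar L' u ∣ u.asIdeal.ramificationIdx (𝓞 L) := htame' u (by rw [h2]; exact h2ℓ)
        have h1 := multiplicity_differentIdeal_le_of_not_dvd L L' u.asIdeal ht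
        have h3 := Nat.le_of_dvd (Ideal.ramificationIdx_pos u.asIdeal ℤ) (ramificationIdx_rel_dvd_ramificationIdx_int L L' u.asIdeal)
        omega
      · -- over `ℓ`: Dedekind–Hensel with `v_ℓ(N) ≤ 1`
        have hc : c (residueChar L' u) = 2 := by simp only [c, hl, if_true]
        rw [hc]
        have h1 := multiplicity_differentIdeal_lt_of_isGalois L L' u.asIdeal hN hdvdN
        change multiplicity u.asIdeal (differentIdeal (𝓞 L) (𝓞 L')) + 1 ≤
          u.asIdeal.ramificationIdx ℤ * (N.factorization (residueChar L' u) + 1) at h1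
        rw [hl] at h1
        have h3 : u.asIdeal.ramificationIdx ℤ * (N.factorization ℓ + 1) ≤ u.asIdeal.ramificationIdx ℤ * 2 :=
          Nat.mul_le_mul_left _ (by omega)
        have := h1.trans h3
        rw [mul_comm] at this
        omega)
  have hsum : ∑ p ∈ ({2, ℓ} : Finset ℕ), (c p : ℝ) * Real.log p = 2 * Real.log ℓ + Real.log 2 := by
    rw [Finset.sum_pair h2ℓ]
    simp only [c, if_neg h2ℓ, if_true]
    push_cast
    ring
  rw [hsum] at key
  exact key

end Fields

/-! ## 2. The `L′/L`-level display and `WildBoundLp` at the genuine theta tower -/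

namespace MainBoundDatum

section Theta

variable (Lmod : Type*) [Field Lmod] [NumberField Lmod]
variable {P : NFPoint} {F : Type} [Field F] [NumberField F] [Algebra P.F F]
  {K : Type} [Field K] [NumberField K] [Algebra F K] [Algebra P.F K] [IsScalarTower P.F F K]
  (ψ : K →ₐ[F] AlgebraicClosure F)
variable {ℓ : ℕ} (hℓ : ℓ.Prime) (h5 : 5 ≤ ℓ)
variable (hq : 0 < (TateDivisorDatum.ofNFPointOver P {2, ℓ} F).logq)

/-- Support compatibility along `L ⊆ L′`: `Supp(𝔮_{L′})` is the set of places over `Supp(𝔮_L)` (both being the places over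
`Supp(𝔮_{L_tpd})`, T-26). [folklore] -/
theorem thetaTower_supp_iff (u : HeightOneSpectrum (𝓞 K)) :
    u ∈ (TateDivisorDatum.ofNFPointOver P {2, ℓ} K).V ↔ finBelow F K u ∈ (TateDivisorDatum.ofNFPointOver P {2, ℓ} F).V := by
  rw [TateDivisorDatum.mem_ofNFPointOver_V_iff, TateDivisorDatum.mem_ofNFPointOver_V_iff, finBelow_finBelow P.F F K u]

omit [NumberField K] [Algebra P.F K] [IsScalarTower P.F F K] in
include hℓ in
/-- At a place `u` of `L′` of residue characteristic `∉ {2, ℓ}` NOT over `Supp(𝔮_L)`, the place of `L_tpd` under `u` is a good place of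
`λ` (a bad place of residue characteristic `∉ {2,ℓ}` lies in `Supp(𝔮_{L_tpd})`). [folklore] -/
theorem thetaTower_good_below (u : HeightOneSpectrum (𝓞 K)) (hne : residueChar K u ≠ ℓ) (h2 : residueChar K u ≠ 2)
    (hV : finBelow F K u ∉ (TateDivisorDatum.ofNFPointOver P {2, ℓ} F).V) :
    finBelow P.F F (finBelow F K u) ∉ badPlaces P := by
  intro hbad
  apply hV
  rw [TateDivisorDatum.mem_ofNFPointOver_V_iff, TateDivisorDatum.mem_ofNFPoint_V]
  refine ⟨hbad, fun p hp => ?_⟩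
  simp only [Finset.mem_insert, Finset.mem_singleton] at hp
  rcases hp with rfl | rfl
  · intro hmem
    rw [natCast_mem_asIdeal_iff_residueChar_eq _ Nat.prime_two, residueChar_finBelow, residueChar_finBelow] at hmem
    exact h2 hmem
  · intro hmem
    rw [natCast_mem_asIdeal_iff_residueChar_eq _ hℓ, residueChar_finBelow, residueChar_finBelow] at hmem
    exact hne hmem

include hℓ h5 in
/-- **The `L′/L`-level Step (ii) display at the genuine theta tower, HYPOTHESIS-FREE**: `log(d^{L′}) + log(f^{L′}) ≤ log(d^L) + log(f^L)
+ 2·log ℓ + log 2` — `L′/L` is unramified at the good places `∤ ℓ` (`ramificationIdx_divisionTower_eq_one`, Prop. 1.8 (vii)) and TAME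
at every place `∤ ℓ`, in particular at bad places over `2` (`not_dvd_ramificationIdx_divisionTower`), with `Gal(L′/L) ↪ GL₂(𝔽_ℓ)`
(`finrank_divisionTower_dvd`); so §1 applies. The `log 2` is the price of multiplicative reduction over `2`, which Joshi's
`V^{odd,ss}` / the `{2,ℓ}`-avoiding conductor do not see. [claim: Mochizuki2012, status: disputed] -/
theorem thetaTower_sharp642KF (hU : P.InU) (hF : IsThetaField P F) [IsGalois F K]
    (hK : letI := thetaCurve_isElliptic hU F
      ((thetaCurve P F).galoisRepTorsion (ℓ : ℤ)).ker ≤ ψ.fieldRange.fixingSubgroup) :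
    logDifferent K + (TateDivisorDatum.ofNFPointOver P {2, ℓ} K).logf ≤
      logDifferent F + (TateDivisorDatum.ofNFPointOver P {2, ℓ} F).logf + (2 * Real.log ℓ + Real.log 2) := by
  haveI : Fact ℓ.Prime := ⟨hℓ⟩
  refine sharp642_of_tame hℓ h5 _ _ thetaTower_supp_iff (finrank_divisionTower_dvd ψ hU hK) ?_ ?_
  · intro u hne h2 hV
    exact ramificationIdx_divisionTower_eq_one ψ hU hF hK u (natCast_notMem_finBelow_of_residueChar_ne hℓ u hne)
      (thetaTower_good_below hℓ u hne h2 hV)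
  · intro u hne
    exact not_dvd_ramificationIdx_divisionTower ψ hU hF hℓ hK u (natCast_notMem_finBelow_of_residueChar_ne hℓ u hne)
      (residueChar_prime K u) hne

include hℓ h5 in
/-- **The `L′/L`-level display with Mochizuki's constant `2·log ℓ`** at the genuine theta tower, assuming «no bad place of `λ` over `2`»
(Joshi's Prop. 4.1.1 (2), p.38 l.17 «`C/L` has good or additive reduction if `v | 2ℓ`», the `2`-part): then `L′/L` is unramified at EVERY
place `∤ ℓ` off `Supp(𝔮_L)` and T-30's `ofGenuine_sharp642` applies verbatim. [claim: Mochizuki2012, status: disputed] -/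
theorem thetaTower_sharp642KF_of_good_over_two (hU : P.InU) (hF : IsThetaField P F) [IsGalois F K]
    (hK : letI := thetaCurve_isElliptic hU F
      ((thetaCurve P F).galoisRepTorsion (ℓ : ℤ)).ker ≤ ψ.fieldRange.fixingSubgroup)
    (h2 : ∀ v ∈ badPlaces P, ((2 : ℕ) : 𝓞 P.F) ∉ v.asIdeal) :
    logDifferent K + (TateDivisorDatum.ofNFPointOver P {2, ℓ} K).logf ≤
      logDifferent F + (TateDivisorDatum.ofNFPointOver P {2, ℓ} F).logf + 2 * Real.log ℓ := by
  haveI : Fact ℓ.Prime := ⟨hℓ⟩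
  refine ofGenuine_sharp642 hℓ h5 _ _ thetaTower_supp_iff (finrank_divisionTower_dvd ψ hU hK) ?_ ?_
  · intro u hne hV
    refine ramificationIdx_divisionTower_eq_one ψ hU hF hK u (natCast_notMem_finBelow_of_residueChar_ne hℓ u hne) ?_
    by_cases h2u : residueChar K u = 2
    · intro hbad
      refine h2 _ hbad ?_
      rw [natCast_mem_asIdeal_iff_residueChar_eq _ Nat.prime_two, residueChar_finBelow, residueChar_finBelow]
      exact h2u
    · exact thetaTower_good_below hℓ u hne h2u hV
  · intro u hne _
    exact not_dvd_ramificationIdx_divisionTower ψ hU hF hℓ hK u (natCast_notMem_finBelow_of_residueChar_ne hℓ u hne)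
      (residueChar_prime K u) hne

include hℓ h5 in
/-- **Thm. 4.6.1 (5) at `L′/L` WITH THE ADDITIVE WILD CORRECTION, hypothesis-free at the genuine theta tower**:
`(log d^{L′} + log f^{L′}) − (log d^L + log f^L) ≤ 1·log[L′:L] + (2·log ℓ + log 2)` — the honest form of the typed `WildBoundLp`
(whose right side is `1·log[L′:L]` alone; `ofGenuine` reads `[L′:L] = Module.finrank L L′`). [claim: Joshi2024ATS4, status: disputed] -/
theorem thetaTower_wildBoundLp_honest (hU : P.InU) (hF : IsThetaField P F) [IsGalois F K]
    (hK : letI := thetaCurve_isElliptic hU F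
      ((thetaCurve P F).galoisRepTorsion (ℓ : ℤ)).ker ≤ ψ.fieldRange.fixingSubgroup) :
    logDifferent K + (TateDivisorDatum.ofNFPointOver P {2, ℓ} K).logf -
        (logDifferent F + (TateDivisorDatum.ofNFPointOver P {2, ℓ} F).logf) ≤
      1 * Real.log (Module.finrank F K : ℕ) + (2 * Real.log ℓ + Real.log 2) := by
  have key := thetaTower_sharp642KF ψ hℓ h5 hU hF hK
  have hdeg : 0 ≤ Real.log (Module.finrank F K : ℕ) := Real.log_nonneg (by exact_mod_cast Module.finrank_pos)
  linarith

include h5 in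
/-- `2·log ℓ + log 2 = log(2ℓ²) ≤ log [L′ : L]` above the floor `2ℓ² ≤ [L′ : L]`. [folklore] -/
theorem two_log_add_log_two_le {n : ℕ} (hn : 2 * ℓ ^ 2 ≤ n) : 2 * Real.log ℓ + Real.log 2 ≤ Real.log n := by
  have hℓ0 : (0 : ℝ) < ℓ := by exact_mod_cast (show 0 < ℓ by omega)
  have h : (2 : ℝ) * (ℓ : ℝ) ^ 2 ≤ n := by exact_mod_cast hn
  calc 2 * Real.log ℓ + Real.log 2 = Real.log (2 * (ℓ : ℝ) ^ 2) := by
        rw [Real.log_mul (by norm_num) (pow_ne_zero 2 hℓ0.ne'), Real.log_pow]; push_cast; ring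
    _ ≤ Real.log n := Real.log_le_log (by positivity) h

/-- **`WildBoundLp` DERIVED at the genuine theta tower above the degree floor `2ℓ² ≤ [L′ : L]`** — hypothesis-free otherwise
(`Δ ≤ 2·log ℓ + log 2 = log(2ℓ²) ≤ log[L′:L]`). [claim: Joshi2024ATS4, status: disputed] -/
theorem thetaTower_wildBoundLp_of_le_finrank (hU : P.InU) (hF : IsThetaField P F) [IsGalois F K]
    (hK : letI := thetaCurve_isElliptic hU F
      ((thetaCurve P F).galoisRepTorsion (ℓ : ℤ)).ker ≤ ψ.fieldRange.fixingSubgroup)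
    (hdeg : 2 * ℓ ^ 2 ≤ Module.finrank F K) :
    (ofGenuine Lmod hℓ h5 (TateDivisorDatum.ofNFPoint P {2, ℓ}) (TateDivisorDatum.ofNFPointOver P {2, ℓ} F)
      (TateDivisorDatum.ofNFPointOver P {2, ℓ} K) hq).WildBoundLp :=
  wildBoundLp_of_sharp_le _ (thetaTower_sharp642KF ψ hℓ h5 hU hF hK) (two_log_add_log_two_le h5 hdeg)

/-- **`WildBoundLp` DERIVED at the genuine theta tower above the floor `ℓ² ≤ [L′ : L]` when `λ` has no bad place over `2`**
(Prop. 4.1.1 (2); `Δ ≤ 2·log ℓ = log(ℓ²) ≤ log[L′:L]`). [claim: Joshi2024ATS4, status: disputed] -/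
theorem thetaTower_wildBoundLp_of_sq_le_finrank (hU : P.InU) (hF : IsThetaField P F) [IsGalois F K]
    (hK : letI := thetaCurve_isElliptic hU F
      ((thetaCurve P F).galoisRepTorsion (ℓ : ℤ)).ker ≤ ψ.fieldRange.fixingSubgroup)
    (h2 : ∀ v ∈ badPlaces P, ((2 : ℕ) : 𝓞 P.F) ∉ v.asIdeal) (hdeg : ℓ ^ 2 ≤ Module.finrank F K) :
    (ofGenuine Lmod hℓ h5 (TateDivisorDatum.ofNFPoint P {2, ℓ}) (TateDivisorDatum.ofNFPointOver P {2, ℓ} F)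
      (TateDivisorDatum.ofNFPointOver P {2, ℓ} K) hq).WildBoundLp := by
  refine wildBoundLp_of_sharp_le _ (thetaTower_sharp642KF_of_good_over_two ψ hℓ h5 hU hF hK h2) ?_
  have hℓ0 : (0 : ℝ) < ℓ := by exact_mod_cast (show 0 < ℓ by omega)
  have h : (ℓ : ℝ) ^ 2 ≤ (Module.finrank F K : ℕ) := by exact_mod_cast hdeg
  show 2 * Real.log ℓ ≤ Real.log (Module.finrank F K : ℕ)
  calc 2 * Real.log ℓ = Real.log ((ℓ : ℝ) ^ 2) := by rw [Real.log_pow]; push_cast; ring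
    _ ≤ Real.log (Module.finrank F K : ℕ) := Real.log_le_log (by positivity) h

include h5 in
/-- `|SL₂(𝔽_ℓ)| = ℓ(ℓ²−1) ≥ 2ℓ²` for `ℓ ≥ 3`. [folklore] -/
theorem two_mul_sq_le_card_SL : 2 * ℓ ^ 2 ≤ ℓ * (ℓ ^ 2 - 1) := by
  have h1 : 2 * ℓ + 1 ≤ ℓ ^ 2 := by nlinarith
  have h2 : 2 * ℓ ≤ ℓ ^ 2 - 1 := by omega
  calc 2 * ℓ ^ 2 = ℓ * (2 * ℓ) := by ring
    _ ≤ ℓ * (ℓ ^ 2 - 1) := Nat.mul_le_mul_left ℓ h2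

/-- **`WildBoundLp` DERIVED at the genuine theta tower whenever `[L′ : L] ≥ ℓ(ℓ²−1) = |SL₂(𝔽_ℓ)|`** — the case of Joshi's
`L′ = L(E[ℓ])` («the number field determined by Initial Theta Data», p.39 l.16–18) under [IUTchI] Def. 3.1 (c) «the image of
`G_F → GL₂(𝔽_l)` contains `SL₂(𝔽_l)`» (the tree's `Literature.IUT.HodgeTheaters.ImageContainsSL2`; its degree consequence
`|SL₂(𝔽_ℓ)| ≤ [L′:L]` is the hypothesis `hSL` here). [claim: Joshi2024ATS4, status: disputed] -/
theorem thetaTower_wildBoundLp_of_card_SL_le (hU : P.InU) (hF : IsThetaField P F) [IsGalois F K]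
    (hK : letI := thetaCurve_isElliptic hU F
      ((thetaCurve P F).galoisRepTorsion (ℓ : ℤ)).ker ≤ ψ.fieldRange.fixingSubgroup)
    (hSL : ℓ * (ℓ ^ 2 - 1) ≤ Module.finrank F K) :
    (ofGenuine Lmod hℓ h5 (TateDivisorDatum.ofNFPoint P {2, ℓ}) (TateDivisorDatum.ofNFPointOver P {2, ℓ} F)
      (TateDivisorDatum.ofNFPointOver P {2, ℓ} K) hq).WildBoundLp :=
  thetaTower_wildBoundLp_of_le_finrank Lmod ψ hℓ h5 hq hU hF hK ((two_mul_sq_le_card_SL h5).trans hSL)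

include hℓ h5 in
/-- **`log(d^{L′}) ≤ log(d^L) + log(f^L) + 2·log ℓ + log 2`** at the genuine theta tower (drop `log(f^{L′}) ≥ 0`): the different of
ANY Galois layer of the `ℓ`-division tower over a theta field, hypothesis-free. [claim: Mochizuki2012, status: disputed] -/
theorem thetaTower_logDifferent_le (hU : P.InU) (hF : IsThetaField P F) [IsGalois F K]
    (hK : letI := thetaCurve_isElliptic hU F
      ((thetaCurve P F).galoisRepTorsion (ℓ : ℤ)).ker ≤ ψ.fieldRange.fixingSubgroup) :
    logDifferent K ≤ logDifferent F + (TateDivisorDatum.ofNFPointOver P {2, ℓ} F).logf + (2 * Real.log ℓ + Real.log 2) := by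
  have key := thetaTower_sharp642KF ψ hℓ h5 hU hF hK
  have hf := (TateDivisorDatum.ofNFPointOver P {2, ℓ} K).logf_nonneg
  linarith

end Theta

end MainBoundDatum

end Summit.ABC.IUTFork.Joshi.ATS4

end
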